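import Summits.HodgeConjecture.HodgeConjecture.Theorems.Ring2HypothesesDescentAbsoluteOffset
import Literature.AlgebraicGeometry.HodgeTheory.MiddleDimensionReductionHolds
import HarnessLib

/-!
# Ring 2 — hypotheses layer, descent axis: the OFFSET IS A FREE PARAMETER ALREADY FOR HODGE CLASSES — `HC_AV` and the Hodge
# conjecture itself live in every fixed offset `2q − N = ±k` (FACT-FREE), and ROW b06's offset forms hold modulo Deligne's
# theorem (c1) ALONE

HONEST FRAMING (page 1, verbatim the cell's standing line): **research route conditional on HC_CM; not a
corollary; Q11.4-sentence-2 already refuted in dim ≥ 3.** Nothing in this file proves a case of the Hodge conjecture;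
nothing discharges the binder of record b06 `Ring2.Hypotheses.AbsoluteHodgeImpliesAlgebraicAV` (`Ring2HypothesesDescent.lean` :73;
OPEN, `≡ HC_AV` modulo c1); the binder table's numbers do not move. `HC_CM` (`Theses.RankFourFaces.CMAbelianHodge`) does not occur in
this file; `HC_AV` and `HodgeConjecture` occur only inside EQUIVALENCES and are never asserted.

Hodge ladder STAGE 3, `BINDER-OWNERS.md` row **b06**, seat `ring2-b06` (gen 72), seventh file of the gen — the "second road" of the
second file (`Ring2HypothesesDescentAbsoluteOffset`: row b06 and its parent at every fixed offset, modulo (N)+(E)+(c)). For RATIONAL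
`(p,p)`-CLASSES the two paddings need no fact at all: the bare pull-back `pr_X^* c` is rational of type `(p,p)` (the tree's theorems
`IsRationalClass.map`, `IsOfHodgeType.map_of_isSmoothProjective`) and descends by the slice (ring2-b02's
`mem_algebraicClasses_of_map_fst_mem`); the cup product `pr_X^* c ∪ pr_B^* κʲ` is rational of type `(p+j, p+j)` (Künneth + the
multiplicative de Rham theorem, `isOfHodgeType_cupProduct_map_map_of_multiplicative_deRham` with `exists_deRhamIsoFamily_holds`;
`κʲ = Lʲ 1` of type `(j,j)`, `HardLefschetzNFold.isOfHodgeType_L`) and descends by the Gysin push-forward (gen 71's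
`mem_algebraicClasses_of_cross_top_mem`). Hence:

* §1 `hodge_algebraic_of_prod`, `hodge_algebraic_of_cross_prod` — the two fact-free paddings for rational `(p,p)`-classes.
* §2 **`HC_AV_iff_belowMiddleBy k` / `HC_AV_iff_aboveMiddleBy k` — FACT-FREE: `HC_AV ↔` "rational `(q,q)`-classes on complex
  abelian varieties of dimension `2q + k` (resp. `2q − k`, `2 ≤ q ≤ dim − 2`) are algebraic", for EVERY `k`** (`k = 0` is AbelianAll
  XV `HC_AV_iff_forall_middleDegree`, through which the proof goes; count once ab-spread-1's).
* §3 **`hodgeConjecture_iff_belowMiddleBy k` / `hodgeConjecture_iff_aboveMiddleBy k` — FACT-FREE: the summit statement `HodgeConjecture ↔`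
  "rational `(q,q)`-classes on smooth projective `(2q + k)`-folds (resp. `(2q − k)`-folds, `2 ≤ q ≤ dim − 2`) are algebraic"**, for
  every `k` (`k = 0` is BFNP Lemma 48, the tree's `hodgeConjectureFor_of_middleDimension_holds`, through which the proof goes).
* §4 MODULI NESTED: granted Deligne's Main Theorem 2.11 (c1) alone, row b06's offset forms of the second file hold — on an abelian
  variety "absolute Hodge" = "rational `(p,p)`" under c1 — `absoluteHodgeImpliesAlgebraicAV_iff_belowMiddleBy_of_deligne` /
  `…_aboveMiddleBy_of_deligne`: the binder is the same on both roads.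

HONEST COLUMN. Nothing is discharged; «10 · 0» unchanged; `HC_AV`, `HodgeConjecture`, row b06 NOT asserted; c1 is a named fact displayed
as a hypothesis in §4; §1–§3 are fact-free (closures: the three standard axioms); no definition, no named fact, no sorry. NOT claimed:
fixed-codimension forms. COUNT ONCE: XV's middle form and BFNP's reduction are ab-spread-1's / the Literature's; gen 71's Gysin descent
and ring2-b02's slice descent are theirs.

References (bib keys): BrosnanFangNiePearlstein2009 (§6 Lemma 48), KerrPearlstein2011 (§3.1), Deligne1982HodgeCycles (Main Thm. 2.11,
§2 Ex. 2.1), CharlesSchnell2014Notes (Def. 11.2.3), VoisinHodgeI2002 (Thm. 6.25, Rem. 6.27, §7.1.2, §7.3.2, §11.3.2 Thm. 11.38, Thm. 11.30),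
VoisinHodgeII2003 (§9.2.4 Prop. 9.21), Fulton1998 (§10.1 Cor. 10.1), FultonYoungTableaux1997 (App. B §B.1), HatcherAT2002 (§3.3 Thm. 3.26),
MumfordAV1970 (§1), SilvermanAEC2009 (III.3.6), Deligne2000 (§1). -/

noncomputable section

set_option linter.dupNamespace false

open CategoryTheory AlgebraicGeometry MonoidalCategory CartesianMonoidalCategory
open Literature.AlgebraicTopology.SingularHomology Literature.Geometry.Kaehler
open Literature.AlgebraicGeometry Literature.AlgebraicGeometry.Motives
open Literature.AlgebraicGeometry.HodgeTheory
open Summit.HodgeConjecture.HodgeConjecture.Theorems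
open Summit.HodgeConjecture.HodgeConjecture.Theses.PadicSemiregularLift (HodgeAbelianVarieties)
open Summit.HodgeConjecture.HodgeConjecture.Ring2.Binders (mem_algebraicClasses_of_map_fst_mem)

namespace Summit.HodgeConjecture.HodgeConjecture.Ring2.Hypotheses

/-! ## §1 The two paddings for rational `(p,p)`-classes (fact-free) -/

section Padding

variable {n j : ℕ} {X B : SchemeOver ℂ}

/-- **DOWN: `pr_X^* c` on `X × B`** (fact-free). `X` smooth projective of dimension `n`, `B` a complex abelian variety: if every rational
`(q,q)`-class on `X × B` (dimension parameter `n + dim B`) is algebraic, so is every rational `(q,q)`-class `c` on `X` — `pr_X^* c` is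
rational of type `(q,q)` (`IsRationalClass.map`, `IsOfHodgeType.map_of_isSmoothProjective`) and the slice `X × {t}` brings
algebraicity back (ring2-b02's `mem_algebraicClasses_of_map_fst_mem`). [cite: VoisinHodgeI2002, §7.3.2 and §11.3.2 Thm. 11.38]
[cite: Fulton1998, §10.1 Cor. 10.1] -/
theorem hodge_algebraic_of_prod (hX : IsSmoothProjective n X) (B : AbelianVariety ℂ) {q : ℕ}
    (hprod : ∀ c' : complexBetti (X ⊗ B.X) (2 * q), IsRationalClass c' →
      IsOfHodgeType (n + B.dim) (X ⊗ B.X) (2 * q) q q c' → c' ∈ algebraicClasses (X ⊗ B.X) q)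
    (c : complexBetti X (2 * q)) (hc : IsRationalClass c) (hqq : IsOfHodgeType n X (2 * q) q q c) :
    c ∈ algebraicClasses X q :=
  have hXB : IsSmoothProjective (n + B.dim) (X ⊗ B.X) :=
    IsSmoothProjective.tensor_holds hX (AbelianVariety.isSmoothProjective_holds (A := B))
  mem_algebraicClasses_of_map_fst_mem hX B
    (hprod _ (hc.map (AlgPoints.mapContinuous (L := ℂ) (fst X B.X))) (hqq.map_of_isSmoothProjective hXB hX (fst X B.X)))

/-- **UP: `pr_X^* c ∪ pr_B^* κʲ` on `X × B`** (fact-free). `X`, `B` smooth projective of dimensions `n`, `j`, `κ` a polarisation class of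
`B`: if every rational `(p+j, p+j)`-class on `X × B` is algebraic, so is every rational `(p,p)`-class `a` on `X` — `κʲ = L_κʲ 1 ≠ 0` is
rational of type `(j,j)` (`HardLefschetzNFold.isOfHodgeType_L` from `1` of type `(0,0)`), the exterior product is rational of type
`(p+j, p+j)` (Künneth and the multiplicative de Rham theorem, `isOfHodgeType_cupProduct_map_map_of_multiplicative_deRham` with the
tree's `exists_deRhamIsoFamily_holds`), and the Gysin push-forward along `pr_X` descends (gen 71's `mem_algebraicClasses_of_cross_top_mem`).
[cite: VoisinHodgeI2002, Thm. 6.25, Rem. 6.27, §7.3.2 and §11.3.2 Thm. 11.38] [cite: VoisinHodgeII2003, §9.2.4 Prop. 9.21]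
[cite: FultonYoungTableaux1997, Appendix B §B.1 (5)–(7)] -/
theorem hodge_algebraic_of_cross_prod (hX : IsSmoothProjective n X) (hB : IsSmoothProjective j B) {κ : complexBetti B 2}
    (hκ : IsPolarizationClass j B κ) {p : ℕ}
    (hmid : ∀ z : complexBetti (X ⊗ B) (2 * (p + j)), IsRationalClass z →
      IsOfHodgeType (n + j) (X ⊗ B) (2 * (p + j)) (p + j) (p + j) z → z ∈ algebraicClasses (X ⊗ B) (p + j))
    (a : complexBetti X (2 * p)) (ha : IsRationalClass a) (happ : IsOfHodgeType n X (2 * p) p p a) :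
    a ∈ algebraicClasses X p := by
  have hXB : IsSmoothProjective (n + j) (X ⊗ B) := IsSmoothProjective.tensor_holds hX hB
  haveI := pathConnectedSpace_complexPoints hB
  obtain ⟨Λ, rfl⟩ := hκ.exists_hardLefschetzNFold hB
  -- `κʲ = Lʲ 1 ≠ 0`, rational of type `(j,j)`
  have hν : lefschetzPowTo Λ.hyperplaneClass j 0 (2 * j) (by omega) (singularCohomology.one ℂ (ComplexPoints B)) ≠ 0 := by
    intro h0
    have hinj := (bijective_lefschetzPowTo_of_hasHardLefschetz Λ.hyperplaneClass Λ.hasHardLefschetz (show 0 + j = j by omega)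
      (2 * j) (by omega)).1
    exact singularCohomology_one_ne_zero (R := ℂ) (M := ComplexPoints B) (hinj (h0.trans (map_zero _).symm))
  have hνrat : IsRationalClass (lefschetzPowTo Λ.hyperplaneClass j 0 (2 * j) (by omega)
      (singularCohomology.one ℂ (ComplexPoints B))) :=
    Λ.isRationalClass_hyperplaneClass.lefschetzPowTo j 0 (2 * j) (by omega) (isRationalClass_one _)
  have hνtyp : IsOfHodgeType j B (2 * j) j j (lefschetzPowTo Λ.hyperplaneClass j 0 (2 * j) (by omega)
      (singularCohomology.one ℂ (ComplexPoints B))) := by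
    have h := Λ.isOfHodgeType_L j 0 (2 * j) (by omega) 0 0
      (isAbsoluteHodgeClass_degree_zero hB _ (isRationalClass_one _)).isOfHodgeType
    rwa [Nat.zero_add] at h
  refine mem_algebraicClasses_of_cross_top_mem hX hB hν (hmid _ ?_ ?_)
  · exact (ha.map (AlgPoints.mapContinuous (L := ℂ) (fst X B))).cup _ (hνrat.map (AlgPoints.mapContinuous (L := ℂ) (snd X B)))
  · exact isOfHodgeType_cupProduct_map_map_of_multiplicative_deRham
      (fun E _ _ _ ↦ Literature.NumberTheory.Transcendental.exists_deRhamIsoFamily_holds E) hXB hX hB (fst X B) (snd X B)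
      (show 2 * p + 2 * j = 2 * (p + j) by omega) happ hνtyp

end Padding

/-! ## §2 `HC_AV` at every fixed offset (fact-free) -/

section HCAV

/-- **`HC_AV ↔` "rational `(q,q)`-classes on complex abelian `(2q + k)`-folds, `q ≥ 2`, are algebraic" — EVERY `k`, FACT-FREE.** `⟹`
restriction; `⟸`: AbelianAll XV's middle form (`HC_AV_iff_forall_middleDegree`: middle classes of even-dimensional abelian varieties of
dimension `≥ 4`) follows by padding a middle class DOWN to offset `−k` on `A × B`, `dim B = k` (§1 `hodge_algebraic_of_prod`).
Neither side is asserted. [cite: BrosnanFangNiePearlstein2009, §6 Lemma 48] [cite: KerrPearlstein2011, §3.1] [cite: MumfordAV1970, §1] -/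
theorem HC_AV_iff_belowMiddleBy (k : ℕ) :
    HodgeAbelianVarieties ↔
      ∀ (C : AbelianVariety ℂ) (q : ℕ), 2 ≤ q → 2 * q + k = C.dim →
        ∀ c : complexBetti C.X (2 * q), IsRationalClass c → IsOfHodgeType C.dim C.X (2 * q) q q c →
          c ∈ algebraicClasses C.X q := by
  refine ⟨fun h C q _ _ c hc hqq ↦ (h C).2 q c hc hqq, fun h ↦ AbelianAll.HC_AV_iff_forall_middleDegree.2 ?_⟩
  intro A m hm hA c hc hmm
  have hAsp : IsSmoothProjective (2 * m) A.X := hA ▸ AbelianVariety.isSmoothProjective_holds (A := A)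
  rcases Nat.eq_zero_or_pos k with rfl | hk
  · exact h A m hm (by omega) c hc (by rw [hA]; exact hmm)
  · obtain ⟨B, hBd⟩ := exists_abelianVariety_dim_eq_succ ℂ (k - 1)
    refine hodge_algebraic_of_prod hAsp B (fun z hz hzz ↦ ?_) c hc hmm
    have hd : (A.prod B).dim = 2 * m + B.dim := by rw [AbelianVariety.dim_prod, hA]
    have h' := h (A.prod B) m hm (by rw [hd]; omega) z hz
    rw [hd] at h'
    exact h' hzz

/-- **`HC_AV ↔` "rational `(q,q)`-classes on complex abelian varieties of dimension `N`, `2q = N + k`, `2 ≤ q ≤ N − 2`, are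
algebraic" — EVERY `k`, FACT-FREE**: pad a middle class UP to offset `k` by `κᵏ` on `A × B`, `dim B = k` (§1
`hodge_algebraic_of_cross_prod`), then AbelianAll XV. Neither side is asserted. [cite: BrosnanFangNiePearlstein2009, §6 Lemma 48]
[cite: VoisinHodgeII2003, §9.2.4 Prop. 9.21] [cite: MumfordAV1970, §1] -/
theorem HC_AV_iff_aboveMiddleBy (k : ℕ) :
    HodgeAbelianVarieties ↔
      ∀ (C : AbelianVariety ℂ) (q : ℕ), 2 ≤ q → q + 2 ≤ C.dim → 2 * q = C.dim + k →
        ∀ c : complexBetti C.X (2 * q), IsRationalClass c → IsOfHodgeType C.dim C.X (2 * q) q q c →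
          c ∈ algebraicClasses C.X q := by
  refine ⟨fun h C q _ _ _ c hc hqq ↦ (h C).2 q c hc hqq, fun h ↦ AbelianAll.HC_AV_iff_forall_middleDegree.2 ?_⟩
  intro A m hm hA c hc hmm
  have hAsp : IsSmoothProjective (2 * m) A.X := hA ▸ AbelianVariety.isSmoothProjective_holds (A := A)
  rcases Nat.eq_zero_or_pos k with rfl | hk
  · exact h A m hm (by omega) (by omega) c hc (by rw [hA]; exact hmm)
  · obtain ⟨B, hBd⟩ := exists_abelianVariety_dim_eq_succ ℂ (k - 1)
    have hBsp : IsSmoothProjective B.dim B.X := AbelianVariety.isSmoothProjective_holds (A := B)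
    obtain ⟨κ, hκ⟩ := exists_isPolarizationClass hBsp
    refine hodge_algebraic_of_cross_prod hAsp hBsp hκ (fun z hz hzz ↦ ?_) c hc hmm
    have hd : (A.prod B).dim = 2 * m + B.dim := by rw [AbelianVariety.dim_prod, hA]
    have h' := h (A.prod B) (m + B.dim) (by omega) (by rw [hd]; omega) (by rw [hd]; omega) z hz
    rw [hd] at h'
    exact h' hzz

end HCAV

/-! ## §3 The Hodge conjecture itself at every fixed offset (fact-free) -/

section HC

/-- **`HodgeConjecture ↔` "rational `(q,q)`-classes on smooth projective `(2q + k)`-folds, `q ≥ 2`, are algebraic" — EVERY `k`,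
FACT-FREE.** `⟸`: BFNP's Lemma 48 (the tree's THEOREM `hodgeConjectureFor_of_middleDimension_holds`) asks for the middle classes of all
even-dimensional smooth projective varieties; `m = 0` is trivial (`algebraicClasses_zero`), `m = 1` is Lefschetz `(1,1)`
(`lefschetzOneOne_rational_holds`), and for `m ≥ 2` pad DOWN by an abelian `k`-fold (§1). Neither side is asserted.
[cite: BrosnanFangNiePearlstein2009, §6 Lemma 48] [cite: KerrPearlstein2011, §3.1] [cite: VoisinHodgeI2002, Thm. 11.30] -/
theorem hodgeConjecture_iff_belowMiddleBy (k : ℕ) :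
    _root_.HodgeConjecture ↔
      ∀ ⦃N : ℕ⦄ ⦃Y : SchemeOver ℂ⦄, IsSmoothProjective N Y → ∀ q : ℕ, 2 ≤ q → 2 * q + k = N →
        ∀ c : complexBetti Y (2 * q), IsRationalClass c → IsOfHodgeType N Y (2 * q) q q c → c ∈ algebraicClasses Y q := by
  refine ⟨fun h N Y hY q _ _ c hc hqq ↦ (h hY).2 q c hc hqq, fun h n X hX ↦ hodgeConjectureFor_of_middleDimension_holds ?_ hX⟩
  intro m Y hY c hc hmm
  rcases Nat.lt_or_ge m 2 with hm | hm
  · interval_cases m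
    · rw [algebraicClasses_zero]
      exact Submodule.mem_top
    · exact lefschetzOneOne_rational_holds hY c hc hmm
  rcases Nat.eq_zero_or_pos k with rfl | hk
  · exact h hY m hm (by omega) c hc hmm
  · obtain ⟨B, hBd⟩ := exists_abelianVariety_dim_eq_succ ℂ (k - 1)
    exact hodge_algebraic_of_prod hY B
      (fun z hz hzz ↦ h (IsSmoothProjective.tensor_holds hY (AbelianVariety.isSmoothProjective_holds (A := B))) m hm (by omega)
        z hz hzz) c hc hmm

/-- **`HodgeConjecture ↔` "rational `(q,q)`-classes on smooth projective `N`-folds with `2q = N + k`, `2 ≤ q ≤ N − 2`, are algebraic"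
— EVERY `k`, FACT-FREE** (pad UP by `κᵏ`, §1; then BFNP). Neither side is asserted. [cite: BrosnanFangNiePearlstein2009, §6 Lemma 48]
[cite: VoisinHodgeII2003, §9.2.4 Prop. 9.21] [cite: VoisinHodgeI2002, Thm. 11.30] -/
theorem hodgeConjecture_iff_aboveMiddleBy (k : ℕ) :
    _root_.HodgeConjecture ↔
      ∀ ⦃N : ℕ⦄ ⦃Y : SchemeOver ℂ⦄, IsSmoothProjective N Y → ∀ q : ℕ, 2 ≤ q → q + 2 ≤ N → 2 * q = N + k →
        ∀ c : complexBetti Y (2 * q), IsRationalClass c → IsOfHodgeType N Y (2 * q) q q c → c ∈ algebraicClasses Y q := by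
  refine ⟨fun h N Y hY q _ _ _ c hc hqq ↦ (h hY).2 q c hc hqq, fun h n X hX ↦ hodgeConjectureFor_of_middleDimension_holds ?_ hX⟩
  intro m Y hY c hc hmm
  rcases Nat.lt_or_ge m 2 with hm | hm
  · interval_cases m
    · rw [algebraicClasses_zero]
      exact Submodule.mem_top
    · exact lefschetzOneOne_rational_holds hY c hc hmm
  rcases Nat.eq_zero_or_pos k with rfl | hk
  · exact h hY m hm (by omega) (by omega) c hc hmm
  · obtain ⟨B, hBd⟩ := exists_abelianVariety_dim_eq_succ ℂ (k - 1)
    have hBsp : IsSmoothProjective B.dim B.X := AbelianVariety.isSmoothProjective_holds (A := B)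
    obtain ⟨κ, hκ⟩ := exists_isPolarizationClass hBsp
    exact hodge_algebraic_of_cross_prod hY hBsp hκ
      (fun z hz hzz ↦ h (IsSmoothProjective.tensor_holds hY hBsp) (m + B.dim) (by omega) (by omega) (by omega) z hz hzz) c hc hmm

end HC

/-! ## §4 Moduli nested: row b06's offset forms modulo Deligne's theorem (c1) alone -/

section Deligne

/-- **Granted Deligne's Main Theorem 2.11 (c1) instead of (N)+(E)+(c): ROW b06 `↔` "absolute Hodge classes of codimension `q ≥ 2` on
complex abelian `(2q + k)`-folds are algebraic", every `k`** — on an abelian variety "absolute Hodge" and "rational of type `(p,p)`"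
coincide under c1 (Charles–Schnell Def. 11.2.3 with `σ = id` for `⟹`), row b06 `↔ HC_AV`
(`hc_av_iff_absoluteHodgeImpliesAlgebraicAV_of_deligne`), and `HC_AV` has the fact-free offset form of §2. The binder is the same as on
the (N)+(E)+(c) road (`absoluteHodgeImpliesAlgebraicAV_iff_belowMiddleBy_of_canonical`); c1 is NOT asserted.
[cite: Deligne1982HodgeCycles, Main Thm. 2.11 (p. 19)] [cite: CharlesSchnell2014Notes, Def. 11.2.3] [cite: BrosnanFangNiePearlstein2009, §6 Lemma 48] -/
theorem absoluteHodgeImpliesAlgebraicAV_iff_belowMiddleBy_of_deligne (hD : deligne1982_hodgeClasses_abelianVariety_absoluteHodge)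
    (k : ℕ) :
    AbsoluteHodgeImpliesAlgebraicAV ↔
      ∀ (C : AbelianVariety ℂ) (q : ℕ), 2 ≤ q → 2 * q + k = C.dim →
        ∀ z : complexBetti C.X (2 * q), IsAbsoluteHodgeClass C.dim C.X q z → z ∈ algebraicClasses C.X q := by
  refine ⟨fun h C q _ _ z hz ↦ h C q z hz, fun h ↦ ?_⟩
  rw [← hc_av_iff_absoluteHodgeImpliesAlgebraicAV_of_deligne hD]
  exact (HC_AV_iff_belowMiddleBy k).2 fun C q hq hqC c hc hqq ↦ h C q hq hqC c (hD C q c hc hqq)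

/-- **Granted c1: ROW b06 `↔` "absolute Hodge classes of codimension `q` on complex abelian varieties of dimension `N`, `2q = N + k`,
`2 ≤ q ≤ N − 2`, are algebraic", every `k`** (§2 and `hc_av_iff_absoluteHodgeImpliesAlgebraicAV_of_deligne`). c1 is NOT asserted.
[cite: Deligne1982HodgeCycles, Main Thm. 2.11 (p. 19)] [cite: CharlesSchnell2014Notes, Def. 11.2.3] [cite: BrosnanFangNiePearlstein2009, §6 Lemma 48] -/
theorem absoluteHodgeImpliesAlgebraicAV_iff_aboveMiddleBy_of_deligne (hD : deligne1982_hodgeClasses_abelianVariety_absoluteHodge)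
    (k : ℕ) :
    AbsoluteHodgeImpliesAlgebraicAV ↔
      ∀ (C : AbelianVariety ℂ) (q : ℕ), 2 ≤ q → q + 2 ≤ C.dim → 2 * q = C.dim + k →
        ∀ z : complexBetti C.X (2 * q), IsAbsoluteHodgeClass C.dim C.X q z → z ∈ algebraicClasses C.X q := by
  refine ⟨fun h C q _ _ _ z hz ↦ h C q z hz, fun h ↦ ?_⟩
  rw [← hc_av_iff_absoluteHodgeImpliesAlgebraicAV_of_deligne hD]
  exact (HC_AV_iff_aboveMiddleBy k).2 fun C q hq hq2 hqC c hc hqq ↦ h C q hq hq2 hqC c (hD C q c hc hqq)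

end Deligne

/-! ## Audit: nothing is decided here

§1–§3 are fact-free (closures: the three standard axioms); §4 carries the undischarged hypothesis c1. No theorem concludes `HC_AV`,
`HodgeConjecture`, `AbsoluteHodgeImpliesAlgebraicAV` or `HC_CM` outright. -/

#print axioms Summit.HodgeConjecture.HodgeConjecture.Ring2.Hypotheses.HC_AV_iff_belowMiddleBy
#print axioms Summit.HodgeConjecture.HodgeConjecture.Ring2.Hypotheses.hodgeConjecture_iff_aboveMiddleBy
#print axioms Summit.HodgeConjecture.HodgeConjecture.Ring2.Hypotheses.absoluteHodgeImpliesAlgebraicAV_iff_belowMiddleBy_of_deligne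

end Summit.HodgeConjecture.HodgeConjecture.Ring2.Hypotheses

end
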